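/-
Origin: expansion seat `planner-pub-hodgecm-mc-glue-1-g11-0`, handover #SG19 2026-08-20T16:55:47Z md5 6fab87417e96 (REPLACE; pre md5 fe0b1fccb8ec → new md5 6fab87417e96; 263 l.; (μ4) scope-guard rewrite of the RUN-55 installed file; family glue-1; compiled ok 0 proof-hole) (`HOME/mc/pub-hodgecm-mc-glue-1-g11/stage56/HodgeCM/Model/E2InstanceOGR21AEPISCWRTC.lean`, md5 6fab87417e96, 263 lines);
landed by the second packager p2 gen 10 (p2-g10) in gate run 56 REPLACES the earlier landed copy of `HodgeCM/Model/E2InstanceOGR21AEPISCWRTC.lean` (seat copy carried the packager Origin header of an earlier run (stripped)).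
-/
/-
Origin: speedrun cell pub-hodgecm, MODEL-CONSTRUCTION sub-cell, unit pub-hodgecm-mc-glue-1-g10 (node E ASSEMBLER, gen 10), seat
planner-pub-hodgecm-mc-glue-1-g10-0, 2026-08-20.  Target in PKG: HodgeCM/Model/E2InstanceOGR21AEPISCWRTC.lean (NEW additive leaf; imports the
installed #399T `E2InstanceOGR21AEPISCWRT` (RUN 45) + binder-1's #56 `Binders/Real34Census` (RUN 48) + binder-1's `Binders/GramWRegime` (RUN 36);
nothing landed imports it).  KERNEL ONLY: 1 theorem, 0 defs, 0 records, nothing cited, MODEL-N ±0, E's term of record unchanged.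
-/
import Summits.HodgeConjecture.HodgeCM.Model.E2InstanceOGR21AEPISCWRT
import Summits.HodgeConjecture.HodgeCM.Model.Binders.Real34Census
import Summits.HodgeConjecture.HodgeCM.Model.Binders.GramWRegime

/-!
# `perL_picardCM_r21AEOGISCWRTC` — #399T with row 17's `CT` RE-THREADED through binder-1's socket `Real34CensusSideT.ofCensus` (#56)

glue-1 (node E assembler), RUN 49+/50.  ONE application of the installed #399T `perL_picardCM_r21AEOGISCWRT`
(`HodgeCM/Model/E2InstanceOGR21AEPISCWRT.lean`, RUN 45) with its binder group `CT` (row 17 `real34` in binder-1's census-T form, one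
`Gen12PinsP.Real34CensusSideT …` record per good sextic canonical context) SUPPLIED by binder-1's RUN-48 socket
`Gen12PinsP.Real34CensusSideT.ofCensus` (#56 `HodgeCM/Model/Binders/Real34Census.lean`) from: the rows-18/19 residual families `hκ`, `homg₃₄`,
`hdense₃₄` ALREADY among #399T's binders (passed through, at the sign datum `SInstance.hG_GOG V c ⟨hemb, GoodCtx⟩` of the OG guard); the regime
facts `isAnisotropic_of_goodCtx` (tree) and `AdelicThetaCore.isAnisotropic_gramW_of_goodCtx` (binder-1, RUN 36) DERIVED from the good sextic
context; LF-continuity of the two (34) pair actions of the guarded S pin DISCHARGED by `SInstance.hLF_P` (sinst, kernel theorem); and FOUR NEW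
E-LEVEL BINDER GROUPS displayed AS TYPED — `Z₂`, `Z₃` (data: the two line archimedean families, `Module.Dual ℂ W →ₗ 𝓢`, per context in the regime),
`hsupply` ((W-0-supply): carch's At-tower supplies, at every thin coset, line `ArchKTypeDataAt` records with archimedean components `Z₂`/`Z₃`,
weakly P-differentiable and P⁻-killed) and `harch` (binder-1's archimedean letter identity in ∃-form: SOME pure-tensor factorisation of `tau34`
whose archimedean part carries the census base vector `φ₀` to a multiple of the `Z₂ ∧ Z₃` wedge) — their texts are #56's `ofCensus` parameter
texts VERBATIM up to the E-level universal prefix `∀ {L} {ι₁} V c (hV : IsAnisotropic L V.Hm)` (+ the sign datum `hW` for `harch`, #399T's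
convention), the instantiation `G ↦ SInstance.GOG`, `hG ↦ SInstance.hG_GOG`, `η hη hηc ↦ EtaChi.* χV (SInstance.χWR …)`,
`AG ↦ SInstance.AR … hpos_GOG hΔ₁ hΔ₂ hΔ₃`, `h₃ ↦ cmAbelianVarietyRealised_of_eigenbasis hHD hI h₃` read off #399T's `CT` type, `jD ↦ jD V c`,
`Zₖ ↦ Zₖ V c hV`, and namespace qualification.
Binder groups: `hA hGR χV hGR₀ hGR₁ hGR₂ hGR₃ μ hΔ₁ hΔ₂ hΔ₃ hR hΘ harch₀ hχ₀ harch₁ hχ₁ jD Z₂ Z₃ hsupply harch hκ homg homg₃₄ hdense₁₂ hdense₃₄`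
(27 = 24 − 1 + 4: `CT` CONSUMED; `Z₂ Z₃ hsupply harch` NEW); every other text is #399T's byte-for-byte; conclusion `Universe.PerL` unchanged;
proof = ONE application.  ADDITIVE LEAF (socket) of the closing chain BESIDE E — E's term of record `perL_picardCM_r21AEOGI` «14 · 0» is untouched;
no new definition, record or cite enters; nothing of PerL ∕ QW8 is claimed.
-/

noncomputable section

open scoped TensorProduct InnerProductSpace Matrix

open Literature.NumberTheory.Automorphic Literature.NumberTheory.Weil1964
open Literature.NumberTheory.GelbartRogawski1991.UnitaryDualPair
open HodgeCM.Adelic HodgeCM.PerL34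
open scoped Classical
open Literature.Geometry.ComplexHyperbolic.BallModel (U21 x₀ stabilizerEquivK21)
open Literature.NumberTheory.Automorphic.U21 (K21 matA sclD)

namespace HodgeCM

namespace Model

open HodgeCM.Model.ArchSideTerm
open HodgeCM.Universe (AdelicThetaCore AdelicThetaCore₀ SideData ThetaModel ModelAxiomsPerL)
open Literature.AlgebraicGeometry.HodgeTheory
open Literature.AlgebraicGeometry.ComplexMultiplication (Shimura1998_Thm3_isogenousPower Shimura1998_Thm2_Cor)
open Literature.NumberTheory.Automorphic.PicardCM
open Literature.NumberTheory.Transcendental (Arapura2012_Cor_15_4_6)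
open HodgeCM.CMTypeOps (inflate)
open HodgeCM.Model.SupplyResidual (ClassSupplyPackN)
open HodgeCM.Model.ThetaSpace

variable (hHD : exists_isReal_hodgeModel) (hI : hodgePQ_independent_of_hodgeModel)
  (h₁ : BallQuotientUniformised)  (h₃ : CMAbelianVarietyEigenbasisRealised)

/-- **#399T with row 17 re-threaded through `Real34CensusSideT.ofCensus`**: `CT` consumed; the residual of row 17 is displayed as the four
E-level groups `Z₂ Z₃ hsupply harch` (rows 18/19's `hκ homg₃₄ hdense₃₄` are shared with #399T's existing groups). One application. -/
theorem perL_picardCM_r21AEOGISCWRTC (hA : Arapura2012_Cor_15_4_6)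
    (hGR : ∀ {L : CMField} {ι₁ : L →+* ℂ} (V : HermSpace3 L ι₁) (c : SeesawCtx L),
      (cmSplittingDatum (L : Type) finProdFinEquiv (frameD V) (frameD_real V) (frameD_ne V) (dW c.D) (dW_real c.D)
        (dW_ne c.D)).CompatibleSplitting)
    (χV : ∀ {L : CMField} {ι₁ : L →+* ℂ} (_V : HermSpace3 L ι₁) (_c : SeesawCtx L),
      ContinuousMonoidHom (relNormOneIdeles (↥(NumberField.maximalRealSubfield (L : Type))) (L : Type) ⧸
        relNormOneRat (↥(NumberField.maximalRealSubfield (L : Type))) (L : Type)) Circle)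
    (hGR₀ : ∀ {L : CMField} {ι₁ : L →+* ℂ} (V : HermSpace3 L ι₁) (c : SeesawCtx L),
      (cmSplittingDatum (L : Type) (e₁) (frameD V) (frameD_real V) (frameD_ne V) (lineVec (L : Type) (dW c.D 0))
        (fun _ => dW_real c.D 0) (fun _ => dW_ne c.D 0)).CompatibleSplitting)
    (hGR₁ : ∀ {L : CMField} {ι₁ : L →+* ℂ} (V : HermSpace3 L ι₁) (c : SeesawCtx L),
      (cmSplittingDatum (L : Type) (e₁) (frameD V) (frameD_real V) (frameD_ne V) (lineVec (L : Type) (dW c.D 1))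
        (fun _ => dW_real c.D 1) (fun _ => dW_ne c.D 1)).CompatibleSplitting)
    (hGR₂ : ∀ {L : CMField} {ι₁ : L →+* ℂ} (V : HermSpace3 L ι₁) (c : SeesawCtx L),
      (cmSplittingDatum (L : Type) (e₁) (frameD V) (frameD_real V) (frameD_ne V) (lineVec (L : Type) (dW' c.D 0))
        (fun _ => dW'_real c.D 0) (fun _ => dW'_ne c.D 0)).CompatibleSplitting)
    (hGR₃ : ∀ {L : CMField} {ι₁ : L →+* ℂ} (V : HermSpace3 L ι₁) (c : SeesawCtx L),
      (cmSplittingDatum (L : Type) (e₁) (frameD V) (frameD_real V) (frameD_ne V) (lineVec (L : Type) (dW' c.D 1))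
        (fun _ => dW'_real c.D 1) (fun _ => dW'_ne c.D 1)).CompatibleSplitting)
    (μ : ∀ {L : CMField}, SeesawCtx L → Fin 4 → NumberField.InfinitePlace L → ℤ)
    (hΔ₁ : ∀ {L : CMField} {ι₁ : L →+* ℂ} (V : HermSpace3 L ι₁) (c : SeesawCtx L), ∀ hc : SInstance.GOG V c,
      slotTypeVec V c (hGR V c) (hGR₀ V c) (hGR₁ V c) (hGR₂ V c) (hGR₃ V c) (SInstance.hG_GOG V c hc) 1 -
        slotTypeVec V c (hGR V c) (hGR₀ V c) (hGR₁ V c) (hGR₂ V c) (hGR₃ V c) (SInstance.hG_GOG V c hc) 0 = μ c 1 - μ c 0)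
    (hΔ₂ : ∀ {L : CMField} {ι₁ : L →+* ℂ} (V : HermSpace3 L ι₁) (c : SeesawCtx L), ∀ hc : SInstance.GOG V c,
      slotTypeVec V c (hGR V c) (hGR₀ V c) (hGR₁ V c) (hGR₂ V c) (hGR₃ V c) (SInstance.hG_GOG V c hc) 2 -
        slotTypeVec V c (hGR V c) (hGR₀ V c) (hGR₁ V c) (hGR₂ V c) (hGR₃ V c) (SInstance.hG_GOG V c hc) 0 = μ c 2 - μ c 0)
    (hΔ₃ : ∀ {L : CMField} {ι₁ : L →+* ℂ} (V : HermSpace3 L ι₁) (c : SeesawCtx L), ∀ hc : SInstance.GOG V c,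
      slotTypeVec V c (hGR V c) (hGR₀ V c) (hGR₁ V c) (hGR₂ V c) (hGR₃ V c) (SInstance.hG_GOG V c hc) 3 -
        slotTypeVec V c (hGR V c) (hGR₀ V c) (hGR₁ V c) (hGR₂ V c) (hGR₃ V c) (SInstance.hG_GOG V c hc) 0 = μ c 3 - μ c 0)
    (hR : DeligneMilne1982_Thm_6_20_full)
    (hΘ : ∀ {L : CMField} {ι₁ : L →+* ℂ} (V : HermSpace3 L ι₁) (c : SeesawCtx L),
      (thetaModelOf hHD hI h₁ (cmAbelianVarietyRealised_of_eigenbasis hHD hI h₃) (orientBitι L ι₁) (embOf hHD hI h₁ (cmAbelianVarietyRealised_of_eigenbasis hHD hI h₃)) (coverOf hHD hI h₁ (cmAbelianVarietyRealised_of_eigenbasis hHD hI h₃) hA) (wmOfInput (HypCensus.Wcm hGR (@EtaChi.η @χV (@SInstance.χWR @hGR @hGR₀ @hGR₁ @μ)) (@EtaChi.hη @χV (@SInstance.χWR @hGR @hGR₀ @hGR₁ @μ)) (@EtaChi.hηc @χV (@SInstance.χWR @hGR @hGR₀ @hGR₁ @μ)))) (thetaOf _ (thetaClassInputOf _ (fun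 V c => thetaSpaceInputOf hHD hI h₁ (cmAbelianVarietyRealised_of_eigenbasis hHD hI h₃) (SInstance.SROG @hGR @χV @hGR₀ @hGR₁ @hGR₂ @hGR₃ @μ hΔ₁ hΔ₂ hΔ₃) V c))) (d12Of μ) (d34Of μ)).GoodCtx ι₁ c → Module.finrank ℚ c.K = 6 ∧ IsNormalClosure ℚ c.K L ∧ (Module.finrank ℚ L = 24 ∨ Module.finrank ℚ L = 48) →
      (NumberField.InfinitePlace.mk ι₁).embedding = ι₁ →
      ∀ i : Fin 4, ∃ Γ₀ : Level V, ∀ Γ ≤ Γ₀,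
        ∃ D : CommonReflexInput c.K (c.Ψ i) c.σ,
          (thetaModelOf hHD hI h₁ (cmAbelianVarietyRealised_of_eigenbasis hHD hI h₃) (orientBitι L ι₁) (embOf hHD hI h₁ (cmAbelianVarietyRealised_of_eigenbasis hHD hI h₃)) (coverOf hHD hI h₁ (cmAbelianVarietyRealised_of_eigenbasis hHD hI h₃) hA) (wmOfInput (HypCensus.Wcm hGR (@EtaChi.η @χV (@SInstance.χWR @hGR @hGR₀ @hGR₁ @μ)) (@EtaChi.hη @χV (@SInstance.χWR @hGR @hGR₀ @hGR₁ @μ)) (@EtaChi.hηc @χV (@SInstance.χWR @hGR @hGR₀ @hGR₁ @μ)))) (thetaOf _ (thetaClassInputOf _ (fun V c => thetaSpaceInputOf hHD hI h₁ (cmAbelianVarietyRealised_of_eigenbasis hHD hI h₃) (SInstance.SROG @hGR @χV @hGR₀ @hGR₁ @hGR₂ @hGR₃ @μ hΔ₁ hΔ₂ hΔ₃) V c))) (d12Of μ) (d34Of μ)).Theta V c i Γ ⊆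
            Submodule.span ℂ (D.surfaceClasses hHD hI h₁ (cmAbelianVarietyRealised_of_eigenbasis hHD hI h₃) V Γ))
    (harch₀ : ∀ {L : CMField} {ι₁ : L →+* ℂ} (V : HermSpace3 L ι₁) (c : SeesawCtx L) (hV : IsAnisotropic L V.Hm) (hG : SInstance.GOG V c) (N : ℕ), ∀ a : UnitaryGroup.arch (↥(NumberField.maximalRealSubfield L)) L (NumberField.IsCMField.complexConj L) 3 V.Hm,
    UnitaryGroup.archAt (↥(NumberField.maximalRealSubfield L)) L (NumberField.IsCMField.complexConj L) 3 V.Hm (UnitaryGroup.cmPlace (L : Type) ι₁)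
        (NumberField.complexConj_smul_infinitePlace (L : Type) _) (NumberField.IsCMField.complexConj_ne_one (L : Type)) a = 1 →
    ∀ ℓ, lineRepD V c.D (hGR V c) (hGR₀ V c) (hGR₁ V c) (hGR₂ V c) (hGR₃ V c) (EtaChi.η @χV (@SInstance.χWR @hGR @hGR₀ @hGR₁ @μ) V c) 0
        (HodgeCM.Adelic.regimeEquiv L V.Hm hV
          (UnitaryGroup.archToAdelic (↥(NumberField.maximalRealSubfield L)) L (NumberField.IsCMField.complexConj L) 3 V.Hm a), 1)
        (SupplyInstance.testFun (↥(NumberField.maximalRealSubfield L)) (Fin 3)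
          (blockFamilyOfAt (L : Type) e₁ (frameD V) (frameD_real V) (frameD_ne V) (lineVec (L : Type) (dW c.D 0))
            (fun _ => dW_real c.D 0) (fun _ => dW_ne c.D 0) ι₁ (blockPosEquiv V) (blockNegEquiv V)
            (posIdxEquivUnit (SInstance.hpos_GOG V c hG).1) (negIdxEquivEmpty (SInstance.hpos_GOG V c hG).1) (degOnePDual Empty) (Literature.Analysis.SegalBargmann.binvPi 1) ℓ)
          (((SInstance.AR @SInstance.GOG @SInstance.hG_GOG @hGR @χV @hGR₀ @hGR₁ @hGR₂ @hGR₃ @μ @SInstance.hpos_GOG @hΔ₁ @hΔ₂ @hΔ₃ V c hG) 0).x₀) N) =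
      SupplyInstance.testFun (↥(NumberField.maximalRealSubfield L)) (Fin 3)
        (blockFamilyOfAt (L : Type) e₁ (frameD V) (frameD_real V) (frameD_ne V) (lineVec (L : Type) (dW c.D 0))
          (fun _ => dW_real c.D 0) (fun _ => dW_ne c.D 0) ι₁ (blockPosEquiv V) (blockNegEquiv V)
          (posIdxEquivUnit (SInstance.hpos_GOG V c hG).1) (negIdxEquivEmpty (SInstance.hpos_GOG V c hG).1) (degOnePDual Empty) (Literature.Analysis.SegalBargmann.binvPi 1) ℓ)
        (((SInstance.AR @SInstance.GOG @SInstance.hG_GOG @hGR @χV @hGR₀ @hGR₁ @hGR₂ @hGR₃ @μ @SInstance.hpos_GOG @hΔ₁ @hΔ₂ @hΔ₃ V c hG) 0).x₀) N)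
    (hχ₀ : ∀ {L : CMField} {ι₁ : L →+* ℂ} (V : HermSpace3 L ι₁) (c : SeesawCtx L) (hG : SInstance.GOG V c), ∀ u : MulAction.stabilizer U21 x₀,
    ((lineScalar_zero V c.D (hGR V c) (hGR₀ V c) (hGR₁ V c) (eta₀ V c.D (EtaChi.η @χV (@SInstance.χWR @hGR @hGR₀ @hGR₁ @μ) V c)) (u : U21) : ℂˣ) : ℂ) *
        ((matA (stabilizerEquivK21.symm u)).det ^
            (lineVacExponentsZero V c (hGR₀ V c) (SInstance.hG_GOG V c hG) (posIdxEquivUnit (SInstance.hpos_GOG V c hG).1)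
              (negIdxEquivEmpty (SInstance.hpos_GOG V c hG).1)).eP *
          sclD (stabilizerEquivK21.symm u) ^
            (lineVacExponentsZero V c (hGR₀ V c) (SInstance.hG_GOG V c hG) (posIdxEquivUnit (SInstance.hpos_GOG V c hG).1)
              (negIdxEquivEmpty (SInstance.hpos_GOG V c hG).1)).eQ) =
      star (sclD (stabilizerEquivK21.symm u)))
    (harch₁ : ∀ {L : CMField} {ι₁ : L →+* ℂ} (V : HermSpace3 L ι₁) (c : SeesawCtx L) (hV : IsAnisotropic L V.Hm) (hG : SInstance.GOG V c) (N : ℕ), ∀ a : UnitaryGroup.arch (↥(NumberField.maximalRealSubfield L)) L (NumberField.IsCMField.complexConj L) 3 V.Hm,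
    UnitaryGroup.archAt (↥(NumberField.maximalRealSubfield L)) L (NumberField.IsCMField.complexConj L) 3 V.Hm (UnitaryGroup.cmPlace (L : Type) ι₁)
        (NumberField.complexConj_smul_infinitePlace (L : Type) _) (NumberField.IsCMField.complexConj_ne_one (L : Type)) a = 1 →
    ∀ ℓ, lineRepD V c.D (hGR V c) (hGR₀ V c) (hGR₁ V c) (hGR₂ V c) (hGR₃ V c) (EtaChi.η @χV (@SInstance.χWR @hGR @hGR₀ @hGR₁ @μ) V c) 1
        (HodgeCM.Adelic.regimeEquiv L V.Hm hV
          (UnitaryGroup.archToAdelic (↥(NumberField.maximalRealSubfield L)) L (NumberField.IsCMField.complexConj L) 3 V.Hm a), 1)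
        (SupplyInstance.testFun (↥(NumberField.maximalRealSubfield L)) (Fin 3)
          (blockFamilyOfAt (L : Type) e₁ (frameD V) (frameD_real V) (frameD_ne V) (lineVec (L : Type) (dW c.D 1))
            (fun _ => dW_real c.D 1) (fun _ => dW_ne c.D 1) ι₁ (blockPosEquiv V) (blockNegEquiv V)
            (posIdxEquivUnit (SInstance.hpos_GOG V c hG).2.1) (negIdxEquivEmpty (SInstance.hpos_GOG V c hG).2.1) (degOnePDual Empty) (Literature.Analysis.SegalBargmann.binvPi 1) ℓ)
          (((SInstance.AR @SInstance.GOG @SInstance.hG_GOG @hGR @χV @hGR₀ @hGR₁ @hGR₂ @hGR₃ @μ @SInstance.hpos_GOG @hΔ₁ @hΔ₂ @hΔ₃ V c hG) 1).x₀) N) =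
      SupplyInstance.testFun (↥(NumberField.maximalRealSubfield L)) (Fin 3)
        (blockFamilyOfAt (L : Type) e₁ (frameD V) (frameD_real V) (frameD_ne V) (lineVec (L : Type) (dW c.D 1))
          (fun _ => dW_real c.D 1) (fun _ => dW_ne c.D 1) ι₁ (blockPosEquiv V) (blockNegEquiv V)
          (posIdxEquivUnit (SInstance.hpos_GOG V c hG).2.1) (negIdxEquivEmpty (SInstance.hpos_GOG V c hG).2.1) (degOnePDual Empty) (Literature.Analysis.SegalBargmann.binvPi 1) ℓ)
        (((SInstance.AR @SInstance.GOG @SInstance.hG_GOG @hGR @χV @hGR₀ @hGR₁ @hGR₂ @hGR₃ @μ @SInstance.hpos_GOG @hΔ₁ @hΔ₂ @hΔ₃ V c hG) 1).x₀) N)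
    (hχ₁ : ∀ {L : CMField} {ι₁ : L →+* ℂ} (V : HermSpace3 L ι₁) (c : SeesawCtx L) (hG : SInstance.GOG V c), ∀ u : MulAction.stabilizer U21 x₀,
    ((lineScalar_one V c.D (hGR V c) (hGR₀ V c) (hGR₁ V c) (eta₁ V c.D (EtaChi.η @χV (@SInstance.χWR @hGR @hGR₀ @hGR₁ @μ) V c)) (u : U21) : ℂˣ) : ℂ) *
        ((matA (stabilizerEquivK21.symm u)).det ^
            (lineVacExponentsOne V c (hGR₁ V c) (SInstance.hG_GOG V c hG) (posIdxEquivUnit (SInstance.hpos_GOG V c hG).2.1)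
              (negIdxEquivEmpty (SInstance.hpos_GOG V c hG).2.1)).eP *
          sclD (stabilizerEquivK21.symm u) ^
            (lineVacExponentsOne V c (hGR₁ V c) (SInstance.hG_GOG V c hG) (posIdxEquivUnit (SInstance.hpos_GOG V c hG).2.1)
              (negIdxEquivEmpty (SInstance.hpos_GOG V c hG).2.1)).eQ) =
      star (sclD (stabilizerEquivK21.symm u)))
    (jD : ∀ {L : CMField} {ι₁ : L →+* ℂ} (_V : HermSpace3 L ι₁) (_c : SeesawCtx L), NumberField.InfinitePlace (L : Type) → Fock.EqVar → Fin 6)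
    (Z₂ : ∀ {L : CMField} {ι₁ : L →+* ℂ} (V : HermSpace3 L ι₁) (c : SeesawCtx L) (hV : IsAnisotropic L V.Hm),
      Module.Dual ℂ (thetaSpaceInputIn hHD hI h₁ (cmAbelianVarietyRealised_of_eigenbasis hHD hI h₃) ((SInstance.SGP @SInstance.GOG @SInstance.hG_GOG @hGR (@EtaChi.η @χV (@SInstance.χWR @hGR @hGR₀ @hGR₁ @μ)) (@EtaChi.hη @χV (@SInstance.χWR @hGR @hGR₀ @hGR₁ @μ)) (@EtaChi.hηc @χV (@SInstance.χWR @hGR @hGR₀ @hGR₁ @μ)) @hGR₀ @hGR₁ @hGR₂ @hGR₃ (@SInstance.AR @SInstance.GOG @SInstance.hG_GOG @hGR @χV @hGR₀ @hGR₁ @hGR₂ @hGR₃ @μ @SInstance.hpos_GOG (fun V c hc => hΔ₁ V c hc) (fun V c hc => hΔ₂ V c hc) (fun V c hc => hΔ₃ V c hc))) V c) hV).W →ₗ[ℂ]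
      SchwartzMap ((thetaSpaceInputIn hHD hI h₁ (cmAbelianVarietyRealised_of_eigenbasis hHD hI h₃) ((SInstance.SGP @SInstance.GOG @SInstance.hG_GOG @hGR (@EtaChi.η @χV (@SInstance.χWR @hGR @hGR₀ @hGR₁ @μ)) (@EtaChi.hη @χV (@SInstance.χWR @hGR @hGR₀ @hGR₁ @μ)) (@EtaChi.hηc @χV (@SInstance.χWR @hGR @hGR₀ @hGR₁ @μ)) @hGR₀ @hGR₁ @hGR₂ @hGR₃ (@SInstance.AR @SInstance.GOG @SInstance.hG_GOG @hGR @χV @hGR₀ @hGR₁ @hGR₂ @hGR₃ @μ @SInstance.hpos_GOG (fun V c hc => hΔ₁ V c hc) (fun V c hc => hΔ₂ V c hc) (fun V c hc => hΔ₃ V c hc))) V c) hV).J →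
        NumberField.mixedEmbedding.mixedSpace (thetaSpaceInputIn hHD hI h₁ (cmAbelianVarietyRealised_of_eigenbasis hHD hI h₃) ((SInstance.SGP @SInstance.GOG @SInstance.hG_GOG @hGR (@EtaChi.η @χV (@SInstance.χWR @hGR @hGR₀ @hGR₁ @μ)) (@EtaChi.hη @χV (@SInstance.χWR @hGR @hGR₀ @hGR₁ @μ)) (@EtaChi.hηc @χV (@SInstance.χWR @hGR @hGR₀ @hGR₁ @μ)) @hGR₀ @hGR₁ @hGR₂ @hGR₃ (@SInstance.AR @SInstance.GOG @SInstance.hG_GOG @hGR @χV @hGR₀ @hGR₁ @hGR₂ @hGR₃ @μ @SInstance.hpos_GOG (fun V c hc => hΔ₁ V c hc) (fun V c hc => hΔ₂ V c hc) (fun V c hc => hΔ₃ V c hc))) V c) hV).K) ℂ)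
    (Z₃ : ∀ {L : CMField} {ι₁ : L →+* ℂ} (V : HermSpace3 L ι₁) (c : SeesawCtx L) (hV : IsAnisotropic L V.Hm),
      Module.Dual ℂ (thetaSpaceInputIn hHD hI h₁ (cmAbelianVarietyRealised_of_eigenbasis hHD hI h₃) ((SInstance.SGP @SInstance.GOG @SInstance.hG_GOG @hGR (@EtaChi.η @χV (@SInstance.χWR @hGR @hGR₀ @hGR₁ @μ)) (@EtaChi.hη @χV (@SInstance.χWR @hGR @hGR₀ @hGR₁ @μ)) (@EtaChi.hηc @χV (@SInstance.χWR @hGR @hGR₀ @hGR₁ @μ)) @hGR₀ @hGR₁ @hGR₂ @hGR₃ (@SInstance.AR @SInstance.GOG @SInstance.hG_GOG @hGR @χV @hGR₀ @hGR₁ @hGR₂ @hGR₃ @μ @SInstance.hpos_GOG (fun V c hc => hΔ₁ V c hc) (fun V c hc => hΔ₂ V c hc) (fun V c hc => hΔ₃ V c hc))) V c) hV).W →ₗ[ℂ]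
      SchwartzMap ((thetaSpaceInputIn hHD hI h₁ (cmAbelianVarietyRealised_of_eigenbasis hHD hI h₃) ((SInstance.SGP @SInstance.GOG @SInstance.hG_GOG @hGR (@EtaChi.η @χV (@SInstance.χWR @hGR @hGR₀ @hGR₁ @μ)) (@EtaChi.hη @χV (@SInstance.χWR @hGR @hGR₀ @hGR₁ @μ)) (@EtaChi.hηc @χV (@SInstance.χWR @hGR @hGR₀ @hGR₁ @μ)) @hGR₀ @hGR₁ @hGR₂ @hGR₃ (@SInstance.AR @SInstance.GOG @SInstance.hG_GOG @hGR @χV @hGR₀ @hGR₁ @hGR₂ @hGR₃ @μ @SInstance.hpos_GOG (fun V c hc => hΔ₁ V c hc) (fun V c hc => hΔ₂ V c hc) (fun V c hc => hΔ₃ V c hc))) V c) hV).J →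
        NumberField.mixedEmbedding.mixedSpace (thetaSpaceInputIn hHD hI h₁ (cmAbelianVarietyRealised_of_eigenbasis hHD hI h₃) ((SInstance.SGP @SInstance.GOG @SInstance.hG_GOG @hGR (@EtaChi.η @χV (@SInstance.χWR @hGR @hGR₀ @hGR₁ @μ)) (@EtaChi.hη @χV (@SInstance.χWR @hGR @hGR₀ @hGR₁ @μ)) (@EtaChi.hηc @χV (@SInstance.χWR @hGR @hGR₀ @hGR₁ @μ)) @hGR₀ @hGR₁ @hGR₂ @hGR₃ (@SInstance.AR @SInstance.GOG @SInstance.hG_GOG @hGR @χV @hGR₀ @hGR₁ @hGR₂ @hGR₃ @μ @SInstance.hpos_GOG (fun V c hc => hΔ₁ V c hc) (fun V c hc => hΔ₂ V c hc) (fun V c hc => hΔ₃ V c hc))) V c) hV).K) ℂ)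
    (hsupply : ∀ {L : CMField} {ι₁ : L →+* ℂ} (V : HermSpace3 L ι₁) (c : SeesawCtx L) (hV : IsAnisotropic L V.Hm)
      (x₂ x₃ : Fin 3 → IsDedekindDomain.FiniteAdeleRing (NumberField.RingOfIntegers ↥(NumberField.maximalRealSubfield L)) ↥(NumberField.maximalRealSubfield L))
        (𝔫₂ 𝔫₃ : Ideal (NumberField.RingOfIntegers ↥(NumberField.maximalRealSubfield L))),
      ∃ (B₂ : ArchKTypeDataAt (thetaSpaceInputIn hHD hI h₁ (cmAbelianVarietyRealised_of_eigenbasis hHD hI h₃) ((SInstance.SGP @SInstance.GOG @SInstance.hG_GOG @hGR (@EtaChi.η @χV (@SInstance.χWR @hGR @hGR₀ @hGR₁ @μ)) (@EtaChi.hη @χV (@SInstance.χWR @hGR @hGR₀ @hGR₁ @μ)) (@EtaChi.hηc @χV (@SInstance.χWR @hGR @hGR₀ @hGR₁ @μ)) @hGR₀ @hGR₁ @hGR₂ @hGR₃ (@SInstance.AR @SInstance.GOG @SInstance.hG_GOG @hGR @χV @hGR₀ @hGR₁ @hGR₂ @hGR₃ @μ @SInstance.hpos_GOG (fun V c hc =>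 hΔ₁ V c hc) (fun V c hc => hΔ₂ V c hc) (fun V c hc => hΔ₃ V c hc))) V c) hV) 2 x₂ 𝔫₂)
        (B₃ : ArchKTypeDataAt (thetaSpaceInputIn hHD hI h₁ (cmAbelianVarietyRealised_of_eigenbasis hHD hI h₃) ((SInstance.SGP @SInstance.GOG @SInstance.hG_GOG @hGR (@EtaChi.η @χV (@SInstance.χWR @hGR @hGR₀ @hGR₁ @μ)) (@EtaChi.hη @χV (@SInstance.χWR @hGR @hGR₀ @hGR₁ @μ)) (@EtaChi.hηc @χV (@SInstance.χWR @hGR @hGR₀ @hGR₁ @μ)) @hGR₀ @hGR₁ @hGR₂ @hGR₃ (@SInstance.AR @SInstance.GOG @SInstance.hG_GOG @hGR @χV @hGR₀ @hGR₁ @hGR₂ @hGR₃ @μ @SInstance.hpos_GOG (fun V c hc => hΔ₁ V c hc) (fun V c hc => hΔ₂ V c hc) (fun V c hc => hΔ₃ V c hc))) V c) hV) 3 x₃ 𝔫₃),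
        B₃.Γ₀ = B₂.Γ₀ ∧ B₂.Φarch = (Z₂ V c hV) ∧ B₃.Φarch = (Z₃ V c hV) ∧
          B₂.IsWeaklyPDiff Literature.AlgebraicGeometry.ShimuraVarieties.BallForms.expP ∧
          (∀ p : Fin 2, B₂.IsPMinusKilledAlong Literature.AlgebraicGeometry.ShimuraVarieties.BallForms.expP (-Complex.I • (Pi.single p 1 : Fin 2 → ℂ))) ∧
          B₃.IsWeaklyPDiff Literature.AlgebraicGeometry.ShimuraVarieties.BallForms.expP ∧
          (∀ p : Fin 2, B₃.IsPMinusKilledAlong Literature.AlgebraicGeometry.ShimuraVarieties.BallForms.expP (-Complex.I • (Pi.single p 1 : Fin 2 → ℂ))))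
    (harch : ∀ {L : CMField} {ι₁ : L →+* ℂ} (V : HermSpace3 L ι₁) (c : SeesawCtx L) (hV : IsAnisotropic L V.Hm)
      (hW : (∀ j, 0 < (ι₁ ((dW c.D) j)).re) ∨ ∀ j, (ι₁ ((dW c.D) j)).re < 0),
      ∃ (Tinf : SchwartzMap (Fin 3 → NumberField.mixedEmbedding.mixedSpace ↥(NumberField.maximalRealSubfield L)) ℂ →
        SchwartzMap (Fin 3 → NumberField.mixedEmbedding.mixedSpace ↥(NumberField.maximalRealSubfield L)) ℂ →
          SchwartzMap (Fin 6 → NumberField.mixedEmbedding.mixedSpace ↥(NumberField.maximalRealSubfield L)) ℂ)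
        (Tf : FinSB ↥(NumberField.maximalRealSubfield L) (Fin 3) →ₗ[ℂ] FinSB ↥(NumberField.maximalRealSubfield L) (Fin 3) →ₗ[ℂ] FinSB ↥(NumberField.maximalRealSubfield L) (Fin 6)),
      (∀ (Φ₂ Φ₃ : SchwartzMap (Fin 3 → NumberField.mixedEmbedding.mixedSpace ↥(NumberField.maximalRealSubfield L)) ℂ) (F₂ F₃ : FinSB ↥(NumberField.maximalRealSubfield L) (Fin 3)),
        ArchSideTerm.tau34 V c.D (piSchwartzBruhatEquiv ↥(NumberField.maximalRealSubfield L) (Fin 3) (Φ₂ ⊗ₜ F₂))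
            (piSchwartzBruhatEquiv ↥(NumberField.maximalRealSubfield L) (Fin 3) (Φ₃ ⊗ₜ F₃)) =
          piSchwartzBruhatEquiv ↥(NumberField.maximalRealSubfield L) (Fin 6) (Tinf Φ₂ Φ₃ ⊗ₜ Tf F₂ F₃)) ∧
      Submodule.span ℂ (Set.range fun p : FinSB ↥(NumberField.maximalRealSubfield L) (Fin 3) × FinSB ↥(NumberField.maximalRealSubfield L) (Fin 3) =>
        Tf p.1 p.2) = ⊤ ∧
      ∃ a : ℂ,
        HypCensus.archVec₃₄ V c.D (hGR V c) ((@EtaChi.η @χV (@SInstance.χWR @hGR @hGR₀ @hGR₁ @μ)) V c) (HypCensus.datumAt V c.D (jD V c) (HypCensus.jIOf V c.D hW)) (fun w => -μ c 2 w) (fun w => -μ c 3 w)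
            (HypCensus.printedAt V c.D hW (jD V c) (fun w => -μ c 2 w) (fun w => -μ c 3 w)).φ₀ =
          a • (Tinf ((Z₂ V c hV) (LinearMap.proj 0)) ((Z₃ V c hV) (LinearMap.proj 1)) - Tinf ((Z₂ V c hV) (LinearMap.proj 1)) ((Z₃ V c hV) (LinearMap.proj 0))))
    (hκ : ∀ {L : CMField} {ι₁ : L →+* ℂ} (V : HermSpace3 L ι₁) (c : SeesawCtx L)
      (hW : (∀ j, 0 < (ι₁ ((dW c.D) j)).re) ∨ ∀ j, (ι₁ ((dW c.D) j)).re < 0), ∀ k : ↥(KInfty V),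
      (((@EtaChi.η @χV (@SInstance.χWR @hGR @hGR₀ @hGR₁ @μ)) V c (HypCensus.kPair V c.D ι₁ V.sylvesterFrame (sylvesterFrame_formCongr V) k) : ℂˣ) : ℂ) *
          ((HypCensus.pinLetterChar V c.D (hGR V c) hW (HypCensus.kVLetters V c.D (HypCensus.lett V c.D k)) : Circle) : ℂ) * HypCensus.dVIota V c.D (HypCensus.lett V c.D k (HypCensus.cmPlace (L : Type) ι₁)) =
        ((Literature.NumberTheory.Automorphic.UnitaryGroup.archKappa (L : Type) V.Hm ι₁ V.sylvesterFrame (sylvesterFrame_formCongr V) k : ℂˣ) : ℂ))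
    (homg : ∀ {L : CMField} {ι₁ : L →+* ℂ} (V : HermSpace3 L ι₁) (c : SeesawCtx L)
      (hW : (∀ j, 0 < (ι₁ ((dW c.D) j)).re) ∨ ∀ j, (ι₁ ((dW c.D) j)).re < 0) (f : FinSB ↥(NumberField.maximalRealSubfield L) (Fin 6))
      (t : (HypCensus.printedAt V c.D hW (jD V c) (fun w => -μ c 0 w) (fun w => -μ c 1 w)).Tg)
      (φ : (HypCensus.printedAt V c.D hW (jD V c) (fun w => -μ c 0 w) (fun w => -μ c 1 w)).F),
      HypCensus.omgW (HypCensus.Wcm hGR (@EtaChi.η @χV (@SInstance.χWR @hGR @hGR₀ @hGR₁ @μ)) (@EtaChi.hη @χV (@SInstance.χWR @hGR @hGR₀ @hGR₁ @μ)) (@EtaChi.hηc @χV (@SInstance.χWR @hGR @hGR₀ @hGR₁ @μ)) V c)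
          (_root_.NumberField.SeesawArchTorus.printedTorusHom (HypCensus.kindOf (L : Type) (frameD V) (frameD_real V) (dW c.D) (dW_real c.D) ι₁ (HypCensus.datumAt V c.D (jD V c) (HypCensus.jIOf V c.D hW)))
            (HypCensus.lamOf (L : Type) (frameD V) (frameD_real V) (dW c.D) (dW_real c.D) ι₁ (HypCensus.datumAt V c.D (jD V c) (HypCensus.jIOf V c.D hW)))
            (HypCensus.lamOf_ne_zero (L : Type) (frameD V) (frameD_real V) (dW c.D) (dW_real c.D) ι₁ (HypCensus.datumAt V c.D (jD V c) (HypCensus.jIOf V c.D hW)))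
            (c.D.jT₁₂.toMonoidHom.comp (_root_.NumberField.SeesawArchTorus.toAdeles (L : Type)))
            (Fock.PrintDict.pinnedVacs (HypCensus.kindOf (L : Type) (frameD V) (frameD_real V) (dW c.D) (dW_real c.D) ι₁ (HypCensus.datumAt V c.D (jD V c) (HypCensus.jIOf V c.D hW)))
              (fun w => -μ c 0 w) (fun w => -μ c 1 w)) t)
          (HypCensus.ins (L : Type) (frameD V) (frameD_real V) (frameD_ne V) (dW c.D) (dW_real c.D) (dW_ne c.D) ι₁ (HypCensus.datumAt V c.D (jD V c) (HypCensus.jIOf V c.D hW))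
            (fun w => -μ c 0 w) (fun w => -μ c 1 w) f φ) =
        HypCensus.ins (L : Type) (frameD V) (frameD_real V) (frameD_ne V) (dW c.D) (dW_real c.D) (dW_ne c.D) ι₁ (HypCensus.datumAt V c.D (jD V c) (HypCensus.jIOf V c.D hW))
          (fun w => -μ c 0 w) (fun w => -μ c 1 w) f ((HypCensus.printedAt V c.D hW (jD V c) (fun w => -μ c 0 w) (fun w => -μ c 1 w)).ωT t φ))
    (homg₃₄ : ∀ {L : CMField} {ι₁ : L →+* ℂ} (V : HermSpace3 L ι₁) (c : SeesawCtx L)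
      (hW : (∀ j, 0 < (ι₁ ((dW c.D) j)).re) ∨ ∀ j, (ι₁ ((dW c.D) j)).re < 0) (f : FinSB ↥(NumberField.maximalRealSubfield L) (Fin 6))
      (t : (HypCensus.printedAt V c.D hW (jD V c) (fun w => -μ c 2 w) (fun w => -μ c 3 w)).Tg)
      (φ : (HypCensus.printedAt V c.D hW (jD V c) (fun w => -μ c 2 w) (fun w => -μ c 3 w)).F),
      HypCensus.omgW (HypCensus.Wcm hGR (@EtaChi.η @χV (@SInstance.χWR @hGR @hGR₀ @hGR₁ @μ)) (@EtaChi.hη @χV (@SInstance.χWR @hGR @hGR₀ @hGR₁ @μ)) (@EtaChi.hηc @χV (@SInstance.χWR @hGR @hGR₀ @hGR₁ @μ)) V c)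
          (_root_.NumberField.SeesawArchTorus.printedTorusHom (HypCensus.kindOf (L : Type) (frameD V) (frameD_real V) (dW c.D) (dW_real c.D) ι₁ (HypCensus.datumAt V c.D (jD V c) (HypCensus.jIOf V c.D hW)))
            (HypCensus.lamOf (L : Type) (frameD V) (frameD_real V) (dW c.D) (dW_real c.D) ι₁ (HypCensus.datumAt V c.D (jD V c) (HypCensus.jIOf V c.D hW)))
            (HypCensus.lamOf_ne_zero (L : Type) (frameD V) (frameD_real V) (dW c.D) (dW_real c.D) ι₁ (HypCensus.datumAt V c.D (jD V c) (HypCensus.jIOf V c.D hW)))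
            (c.D.jT₃₄.toMonoidHom.comp (_root_.NumberField.SeesawArchTorus.toAdeles (L : Type)))
            (Fock.PrintDict.pinnedVacs (HypCensus.kindOf (L : Type) (frameD V) (frameD_real V) (dW c.D) (dW_real c.D) ι₁ (HypCensus.datumAt V c.D (jD V c) (HypCensus.jIOf V c.D hW)))
              (fun w => -μ c 2 w) (fun w => -μ c 3 w)) t)
          (HypCensus.ins₃₄ V c.D (hGR V c) ((@EtaChi.η @χV (@SInstance.χWR @hGR @hGR₀ @hGR₁ @μ)) V c) (HypCensus.datumAt V c.D (jD V c) (HypCensus.jIOf V c.D hW)) (fun w => -μ c 2 w) (fun w => -μ c 3 w) f φ) =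
        HypCensus.ins₃₄ V c.D (hGR V c) ((@EtaChi.η @χV (@SInstance.χWR @hGR @hGR₀ @hGR₁ @μ)) V c) (HypCensus.datumAt V c.D (jD V c) (HypCensus.jIOf V c.D hW)) (fun w => -μ c 2 w) (fun w => -μ c 3 w) f
          ((HypCensus.printedAt V c.D hW (jD V c) (fun w => -μ c 2 w) (fun w => -μ c 3 w)).ωT t φ))
    (hdense₁₂ : ∀ {L : CMField} {ι₁ : L →+* ℂ} (V : HermSpace3 L ι₁) (c : SeesawCtx L)
      (hW : (∀ j, 0 < (ι₁ ((dW c.D) j)).re) ∨ ∀ j, (ι₁ ((dW c.D) j)).re < 0),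
      ∀ Φ ∈ (HypCensus.Wcm hGR (@EtaChi.η @χV (@SInstance.χWR @hGR @hGR₀ @hGR₁ @μ)) (@EtaChi.hη @χV (@SInstance.χWR @hGR @hGR₀ @hGR₁ @μ)) (@EtaChi.hηc @χV (@SInstance.χWR @hGR @hGR₀ @hGR₁ @μ)) V c).SK, HypCensus.toTop (HypCensus.Wcm hGR (@EtaChi.η @χV (@SInstance.χWR @hGR @hGR₀ @hGR₁ @μ)) (@EtaChi.hη @χV (@SInstance.χWR @hGR @hGR₀ @hGR₁ @μ)) (@EtaChi.hηc @χV (@SInstance.χWR @hGR @hGR₀ @hGR₁ @μ)) V c) Φ ∈ closure (HypCensus.toTop (HypCensus.Wcm hGR (@EtaChi.η @χV (@SInstance.χWR @hGR @hGR₀ @hGR₁ @μ)) (@EtaChi.hη @χV (@SInstance.χWR @hGR @hGR₀ @hGR₁ @μ)) (@EtaChi.hηc @χV (@SInstance.χWR @hGR @hGR₀ @hGR₁ @μ)) V c) ''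
        (Submodule.span ℂ (Set.range fun q : FinSB ↥(NumberField.maximalRealSubfield L) (Fin 6) ×
          (HypCensus.printedAt V c.D hW (jD V c) (fun w => -μ c 0 w) (fun w => -μ c 1 w)).F =>
          HypCensus.ins (L : Type) (frameD V) (frameD_real V) (frameD_ne V) (dW c.D) (dW_real c.D) (dW_ne c.D) ι₁ (HypCensus.datumAt V c.D (jD V c) (HypCensus.jIOf V c.D hW))
            (fun w => -μ c 0 w) (fun w => -μ c 1 w) q.1 q.2) : Set (CMSchwartz (L : Type) 6))))
    (hdense₃₄ : ∀ {L : CMField} {ι₁ : L →+* ℂ} (V : HermSpace3 L ι₁) (c : SeesawCtx L)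
      (hW : (∀ j, 0 < (ι₁ ((dW c.D) j)).re) ∨ ∀ j, (ι₁ ((dW c.D) j)).re < 0),
      ∀ Φ ∈ (HypCensus.Wcm hGR (@EtaChi.η @χV (@SInstance.χWR @hGR @hGR₀ @hGR₁ @μ)) (@EtaChi.hη @χV (@SInstance.χWR @hGR @hGR₀ @hGR₁ @μ)) (@EtaChi.hηc @χV (@SInstance.χWR @hGR @hGR₀ @hGR₁ @μ)) V c).SK, HypCensus.toTop (HypCensus.Wcm hGR (@EtaChi.η @χV (@SInstance.χWR @hGR @hGR₀ @hGR₁ @μ)) (@EtaChi.hη @χV (@SInstance.χWR @hGR @hGR₀ @hGR₁ @μ)) (@EtaChi.hηc @χV (@SInstance.χWR @hGR @hGR₀ @hGR₁ @μ)) V c) Φ ∈ closure (HypCensus.toTop (HypCensus.Wcm hGR (@EtaChi.η @χV (@SInstance.χWR @hGR @hGR₀ @hGR₁ @μ)) (@EtaChi.hη @χV (@SInstance.χWR @hGR @hGR₀ @hGR₁ @μ)) (@EtaChi.hηc @χV (@SInstance.χWR @hGR @hGR₀ @hGR₁ @μ)) V c) ''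
        (Submodule.span ℂ (Set.range fun q : FinSB ↥(NumberField.maximalRealSubfield L) (Fin 6) ×
          (HypCensus.printedAt V c.D hW (jD V c) (fun w => -μ c 2 w) (fun w => -μ c 3 w)).F =>
          HypCensus.ins (L : Type) (frameD V) (frameD_real V) (frameD_ne V) (dW c.D) (dW_real c.D) (dW_ne c.D) ι₁ (HypCensus.datumAt V c.D (jD V c) (HypCensus.jIOf V c.D hW))
            (fun w => -μ c 2 w) (fun w => -μ c 3 w) q.1 q.2) : Set (CMSchwartz (L : Type) 6)))) :
     (picardCMUniverse hHD hI h₁ (cmAbelianVarietyRealised_of_eigenbasis hHD hI h₃)).PerL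
:=
  perL_picardCM_r21AEOGISCWRT hHD hI h₁ h₃ hA hGR χV hGR₀ hGR₁ hGR₂ hGR₃ μ hΔ₁ hΔ₂ hΔ₃ hR hΘ harch₀ hχ₀ harch₁ hχ₁
    (fun {L} {ι₁} V c hc hK hemb =>
      Gen12PinsP.Real34CensusSideT.ofCensus @SInstance.GOG @SInstance.hG_GOG @hGR (@EtaChi.η @χV (@SInstance.χWR @hGR @hGR₀ @hGR₁ @μ))
        (@EtaChi.hη @χV (@SInstance.χWR @hGR @hGR₀ @hGR₁ @μ)) (@EtaChi.hηc @χV (@SInstance.χWR @hGR @hGR₀ @hGR₁ @μ)) @hGR₀ @hGR₁ @hGR₂ @hGR₃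
        (@SInstance.AR @SInstance.GOG @SInstance.hG_GOG @hGR @χV @hGR₀ @hGR₁ @hGR₂ @hGR₃ @μ @SInstance.hpos_GOG (fun V c hc => hΔ₁ V c hc) (fun V c hc => hΔ₂ V c hc) (fun V c hc => hΔ₃ V c hc))
        hHD hI h₁ (cmAbelianVarietyRealised_of_eigenbasis hHD hI h₃) (orientBitι L ι₁) hA @μ V c (isAnisotropic_of_goodCtx V hc hK.1)
        (HodgeCM.Universe.AdelicThetaCore.isAnisotropic_gramW_of_goodCtx _ (orientBitι L ι₁) (d12Of μ) (d34Of μ) hc)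
        (SInstance.hG_GOG V c ⟨hemb, (HodgeCM.Universe.AdelicThetaCore.thetaModel_goodCtx_iff _ (orientBitι L ι₁) (d12Of μ) (d34Of μ) ι₁ c).mp hc⟩)
        (jD V c)
        (hκ V c (SInstance.hG_GOG V c ⟨hemb, (HodgeCM.Universe.AdelicThetaCore.thetaModel_goodCtx_iff _ (orientBitι L ι₁) (d12Of μ) (d34Of μ) ι₁ c).mp hc⟩))
        (homg₃₄ V c (SInstance.hG_GOG V c ⟨hemb, (HodgeCM.Universe.AdelicThetaCore.thetaModel_goodCtx_iff _ (orientBitι L ι₁) (d12Of μ) (d34Of μ) ι₁ c).mp hc⟩))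
        (hdense₃₄ V c (SInstance.hG_GOG V c ⟨hemb, (HodgeCM.Universe.AdelicThetaCore.thetaModel_goodCtx_iff _ (orientBitι L ι₁) (d12Of μ) (d34Of μ) ι₁ c).mp hc⟩))
        (Z₂ V c (isAnisotropic_of_goodCtx V hc hK.1)) (Z₃ V c (isAnisotropic_of_goodCtx V hc hK.1))
        (SInstance.hLF_P @SInstance.GOG @SInstance.hG_GOG @hGR (@EtaChi.η @χV (@SInstance.χWR @hGR @hGR₀ @hGR₁ @μ)) (@EtaChi.hη @χV (@SInstance.χWR @hGR @hGR₀ @hGR₁ @μ)) (@EtaChi.hηc @χV (@SInstance.χWR @hGR @hGR₀ @hGR₁ @μ)) @hGR₀ @hGR₁ @hGR₂ @hGR₃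
          (@SInstance.AR @SInstance.GOG @SInstance.hG_GOG @hGR @χV @hGR₀ @hGR₁ @hGR₂ @hGR₃ @μ @SInstance.hpos_GOG (fun V c hc => hΔ₁ V c hc) (fun V c hc => hΔ₂ V c hc) (fun V c hc => hΔ₃ V c hc)) V c 2)
        (SInstance.hLF_P @SInstance.GOG @SInstance.hG_GOG @hGR (@EtaChi.η @χV (@SInstance.χWR @hGR @hGR₀ @hGR₁ @μ)) (@EtaChi.hη @χV (@SInstance.χWR @hGR @hGR₀ @hGR₁ @μ)) (@EtaChi.hηc @χV (@SInstance.χWR @hGR @hGR₀ @hGR₁ @μ)) @hGR₀ @hGR₁ @hGR₂ @hGR₃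
          (@SInstance.AR @SInstance.GOG @SInstance.hG_GOG @hGR @χV @hGR₀ @hGR₁ @hGR₂ @hGR₃ @μ @SInstance.hpos_GOG (fun V c hc => hΔ₁ V c hc) (fun V c hc => hΔ₂ V c hc) (fun V c hc => hΔ₃ V c hc)) V c 3)
        (hsupply V c (isAnisotropic_of_goodCtx V hc hK.1)) (harch V c (isAnisotropic_of_goodCtx V hc hK.1) (SInstance.hG_GOG V c ⟨hemb, (HodgeCM.Universe.AdelicThetaCore.thetaModel_goodCtx_iff _ (orientBitι L ι₁) (d12Of μ) (d34Of μ) ι₁ c).mp hc⟩)))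
    jD hκ homg homg₃₄ hdense₁₂ hdense₃₄

end Model

end HodgeCM
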